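import Summits.QuantumFields.YangMills.Theorems.SwapVirialDeficitSwapRingCommBox
import Summits.QuantumFields.YangMills.Theorems.SwapVirialDeficitSwapRingCeilingBoxTwisted
import HarnessLib

/-!
# The SIGNED σ-twisted box bounds the sector-`z` deficit: `F^S_z ≤ 300·L⁴·(t₂ + s)²` — the converse of w2 g54's ✓`swapCommBox_of_swapRingDeficit_twisted`
# (free-hands support of ⟨stmt-QuantumFields-24197⟩ `SwapVirialDeficit.SwapGluedStiffness`; brick W8 (sector `001` twin) of LEAD ym-line-sfw-p2 g97's steep-window
# Morse–Bott plan — its thin-toron ∕ box input, the `z`-twin of w3 g61's ✓`swapRingDeficit_le_of_commBox`)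

For a general seam sector `z : Fin 3 → Bool` the σ-glued seam bond of `F^S_z` compares `U_{2L−1}` with `g·tw_z(σU₀)`, `tw_z` the centre twist on the links leaving
the planes `x_k = 0` (✓`TT.twist3_apply`).  On the SIGNED box of w2 g54 — commutators `‖[C_μ,C_ν]‖_F ≤ s`, SIGNED relations `‖c·C_{σμ} − centreElem(z μ)·C_μ·c‖_F ≤ s`,
off-tree links ∕ slices within `t₂` of their references, and the seam field within `t₂` of `centreElem(π_z(x))·c` with the parity
`π_z(x) = ⊕_k (z k ∧ x_k ≠ 0)` — the sign-stripped seam field `g̃(x) = centreElem(π_z(x))⁻¹·g(x)` is `t₂`-close to `c`, and along every link `e = (x,k)` the product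
`centreElem(π_z(x))·τ_e·centreElem(π_z(x+ê_k))⁻¹` of parities and twist factor collapses to `centreElem(z k ∧ x_k = −1)` — exactly the sign of the signed relation on the
wrap plane and `1` elsewhere (✓`parity_shift` off the wrap plane, `parity_shift_wrapPlane` on it).  Hence:

* §1 `parity_shift_wrapPlane`, ★ `linkSign_eq` (the parity ∕ twist bookkeeping along a link: `τ_e·centreElem(π_z(x))·centreElem(π_z(x+ê_k)) = centreElem(z k ∧ x_k = −1)`);
* §2 ★★ `swapRingDeficit_le_of_commBox_twisted (z)` — `F^S_z(glue w ∷ r, g) ≤ 300·L⁴·(t₂ + s)²` on the signed box (kinetic bonds `≤ 6L³(2t₂)²/2`-type, Wilson actions by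
  ✓`wilsonAction_le_of_commBox` — the twist and the swap do not change plaquettes —, the seam bond through w3 g61's ✓`frobNorm_gaugeTransform_sub_le_of_twistedSeam` applied
  to `g̃` and the SIGNED letters `centreElem(z k)·C_k`).
The chart form (`chartDeficit L z χ_z (C, U) ≤ 300L⁴(t+s)²`, the sector-`z` thin-toron energy) follows as in ✓`…BlowUpChartDeficitBox` (next file).

HONEST LABEL: fixed-lattice Frobenius-norm bookkeeping; no floor ∕ ceiling ∕ Laplace statement; ⟨24197⟩ ∕ ⟨24196⟩ ∕ ⟨24194⟩ ∕ ⟨24497⟩ OPEN; own crux ⟨22884⟩ OPEN (blocked-on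
⟨19935⟩); no crux, rung of record or summit is proved; the Yang–Mills mass gap is NOT proved; no summit is proved by a line.  THEOREMS ONLY (0 `def`, 0 `sorry`),
standard axioms.  Width seat ym-line-sfw-p2-w3 g65 (cell ym-idea-1, free hands), `--supports stmt-QuantumFields-24197`.
References: [cite: tHooft1979]; [cite: Luscher1983, §2]; [cite: GonzalezarroyoAltes1988].
-/

set_option autoImplicit false

noncomputable section

open MeasureTheory
open scoped BigOperators
open Literature.MathematicalPhysics.QuantumFieldTheory hiding SU2
open Literature.MathematicalPhysics.QuantumLattice

namespace Summit.QuantumFields.YangMills.Theorems.SwapVirialDeficit.SwapRing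

open Summit.QuantumFields.YangMills.Theorems.FemtoTransferGap
open Summit.QuantumFields.YangMills.Theorems.FemtoTransferGap.TT
open Summit.QuantumFields.YangMills.Theorems.FemtoTransferGap.TwoLattice
open Summit.QuantumFields.YangMills.Theorems.FemtoTransferGap.TwoLattice.Flat
open Summit.QuantumFields.YangMills.Theorems.FemtoTransferGap.TwoLattice.Cov
open Summit.QuantumFields.YangMills.Theorems.VirialFluxGap.RingDeficit
open Summit.QuantumFields.YangMills.Theorems.SwapTwistDeficit.PeriodicRingFloor
open Summit.QuantumFields.YangMills.Theorems.SwapVirialDeficit.SwapRingTwisted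
open Summit.QuantumFields.YangMills.Theorems.TwistEaterVolume.Quadratic
open Summit.QuantumFields.YangMills.Theorems.ToronValleyVolume.Lojasiewicz
open Summit.QuantumFields.YangMills.Theorems.ToronValleyVolume.PeriodicRingCeiling

variable {L : ℕ} [NeZero L]

/-! ## §1 Parities and twist factors along a link -/

omit [NeZero L] in
/-- ★ **The parity across the wrap plane**: for `x_k = −1`, `π_z(x + ê_k) = (z k ∧ (−1 : ZMod L) ≠ 0) ⊕ π_z(x)` (the `k`-th summand of the parity switches
off, since `x_k + 1 = 0`). [folklore] -/
theorem parity_shift_wrapPlane (z : Fin 3 → Bool) (x : Site 3 L) (k : Fin 3) (hx : x k = -1) :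
    Bool.xor (z 0 && decide (x.shift k 0 ≠ 0)) (Bool.xor (z 1 && decide (x.shift k 1 ≠ 0)) (z 2 && decide (x.shift k 2 ≠ 0))) =
      Bool.xor (z k && decide ((-1 : ZMod L) ≠ 0))
        (Bool.xor (z 0 && decide (x 0 ≠ 0)) (Bool.xor (z 1 && decide (x 1 ≠ 0)) (z 2 && decide (x 2 ≠ 0)))) := by
  have hsk : (x.shift k) k = x k + 1 := by simp [Site.shift]
  have hsame : decide (x.shift k k ≠ 0) = false := by rw [hsk, hx, neg_add_cancel]; simp
  have hother : ∀ j : Fin 3, j ≠ k → decide (x.shift k j ≠ 0) = decide (x j ≠ 0) := by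
    intro j hj; rw [shift_apply_ne x hj]
  have hxk : decide (x k ≠ 0) = decide ((-1 : ZMod L) ≠ 0) := by rw [hx]
  have hk : k = 0 ∨ k = 1 ∨ k = 2 := by fin_cases k <;> simp
  rcases hk with rfl | rfl | rfl
  · rw [hsame, hother 1 (by decide), hother 2 (by decide), ← hxk]
    generalize z 0 = c
    generalize decide (x 0 ≠ 0) = b
    generalize Bool.xor (z 1 && decide (x 1 ≠ 0)) (z 2 && decide (x 2 ≠ 0)) = R
    revert c b R; decide
  · rw [hsame, hother 0 (by decide), hother 2 (by decide), ← hxk]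
    generalize z 1 = c
    generalize decide (x 1 ≠ 0) = b
    generalize (z 0 && decide (x 0 ≠ 0)) = A
    generalize (z 2 && decide (x 2 ≠ 0)) = C
    revert c b A C; decide
  · rw [hsame, hother 0 (by decide), hother 1 (by decide), ← hxk]
    generalize z 2 = c
    generalize decide (x 2 ≠ 0) = b
    generalize (z 0 && decide (x 0 ≠ 0)) = A
    generalize (z 1 && decide (x 1 ≠ 0)) = B
    revert c b A B; decide

omit [NeZero L] in
/-- ★ **The link sign**: along EVERY link `e = (x, k)`, the twist factor `τ_e = centreElem(z k ∧ x_k = 0)` and the parities of the two endpoints combine to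
`τ_e · centreElem(π_z(x)) · centreElem(π_z(x + ê_k)) = centreElem(z k ∧ x_k = −1)` — the sign of the signed relation on the wrap plane, `1` elsewhere; valid for every
`L` (✓`parity_shift` off the wrap plane, `parity_shift_wrapPlane` on it). [folklore] -/
theorem linkSign_eq (z : Fin 3 → Bool) (x : Site 3 L) (k : Fin 3) :
    centreElem (z k && decide (x k = 0)) *
        centreElem (Bool.xor (z 0 && decide (x 0 ≠ 0)) (Bool.xor (z 1 && decide (x 1 ≠ 0)) (z 2 && decide (x 2 ≠ 0)))) *
        centreElem (Bool.xor (z 0 && decide (x.shift k 0 ≠ 0)) (Bool.xor (z 1 && decide (x.shift k 1 ≠ 0)) (z 2 && decide (x.shift k 2 ≠ 0)))) =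
      centreElem (z k && decide (x k = -1)) := by
  rw [centreElem_mul, centreElem_mul]
  congr 1
  by_cases hx : x k = -1
  · rw [parity_shift_wrapPlane z x k hx, decide_eq_true hx]
    have hd : decide (x k = 0) = decide ((-1 : ZMod L) = 0) := by rw [hx]
    have e : decide ((-1 : ZMod L) ≠ 0) = !decide ((-1 : ZMod L) = 0) := by
      by_cases h : (-1 : ZMod L) = 0 <;> simp [h]
    rw [hd, e]
    generalize Bool.xor (z 0 && decide (x 0 ≠ 0)) (Bool.xor (z 1 && decide (x 1 ≠ 0)) (z 2 && decide (x 2 ≠ 0))) = P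
    generalize z k = c
    generalize decide ((-1 : ZMod L) = 0) = b
    revert P c b; decide
  · rw [parity_shift z x k hx, decide_eq_false hx]
    generalize Bool.xor (z 0 && decide (x 0 ≠ 0)) (Bool.xor (z 1 && decide (x 1 ≠ 0)) (z 2 && decide (x 2 ≠ 0))) = P
    generalize (z k && decide (x k = 0)) = c
    generalize z k = d
    revert P c d; decide

omit [NeZero L] in
/-- Central bookkeeping on a link: for central `a, b, τ` with `b⁻¹ = b`, `(a·u)·(τ·S)·(b·v)⁻¹ = (τ·a·b)·(u·S·v⁻¹)`. [folklore] -/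
theorem seam_conj_factor {a b τ u S v : SU2} (ha : ∀ X : SU2, a * X = X * a) (hb : ∀ X : SU2, b * X = X * b)
    (hτ : ∀ X : SU2, τ * X = X * τ) (hbb : b⁻¹ = b) :
    a * u * (τ * S) * (b * v)⁻¹ = τ * a * b * (u * S * v⁻¹) := by
  rw [mul_inv_rev, hbb]
  calc a * u * (τ * S) * (v⁻¹ * b) = a * (u * τ) * S * (v⁻¹ * b) := by simp only [mul_assoc]
    _ = a * (τ * u) * S * (b * v⁻¹) := by rw [hτ u, hb v⁻¹]
    _ = τ * a * (u * (S * b)) * v⁻¹ := by rw [← mul_assoc a τ u, ha τ]; simp only [mul_assoc]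
    _ = τ * a * (b * (u * S)) * v⁻¹ := by rw [← hb S, ← mul_assoc u b S, ← hb u, mul_assoc b u S]
    _ = τ * a * b * (u * S * v⁻¹) := by simp only [mul_assoc]

/-! ## §2 The sector-`z` deficit on the signed box -/

/-- ★★ **THE SECTOR-`z` σ-GLUED RING DEFICIT IS `≤ 300·L⁴·(t₂ + s)²` ON THE SIGNED σ-TWISTED BOX.**  Tree-gauge coordinates `(w, (r, g))`, ring history
`(glue w ∷ r, g)`, leaders `C μ = w(−ê_μ, μ)` and `c = g 0`; hypotheses (`0 ≤ t₂, s`): commutators `‖C_μC_ν − C_νC_μ‖_F ≤ s`, the SIGNED σ-relations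
`‖c·C_{σμ} − centreElem(z μ)·C_μ·c‖_F ≤ s`, every other off-tree link of slice `0` within `t₂` of its letter, the slices within `t₂` of `glue w`, and the seam field
within `t₂` of `centreElem(π_z(x))·c` — verbatim the conclusions of ✓`swapCommBox_of_swapRingDeficit_twisted` with `52L³√F, 48L³√F` replaced by `s, t₂`.  Proof as
in the principal sector (✓`swapRingDeficit_le_of_commBox`): Wilson actions and kinetic bonds do not see the sector; the twisted seam value is `β_e·(g̃·σU₀)(e)` with the
stripped field `g̃ = centreElem(π_z)⁻¹·g ≈ c` and the link sign `β_e = centreElem(z k ∧ x_k = −1)` (`linkSign_eq`), so w3 g61's seam lemma applies to the SIGNED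
letters `β_e·ℓ_e`. [cite: tHooft1979] [cite: Luscher1983, §2] -/
theorem swapRingDeficit_le_of_commBox_twisted (z : Fin 3 → Bool) {t₂ s : ℝ} (ht₂ : 0 ≤ t₂) (hs : 0 ≤ s)
    (w : OffIdx L → SU2) (r : Fin (2 * L - 1) → GaugeConfig 3 L SU2) (g : Site 3 L → SU2)
    (hCC : ∀ μ ν : Fin 3,
      frobNorm (((w ⟨(Pi.single μ (-1 : ZMod L), μ), leader_not_treeEdge μ⟩ * w ⟨(Pi.single ν (-1 : ZMod L), ν), leader_not_treeEdge ν⟩ : SU2) :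
          Matrix (Fin 2) (Fin 2) ℂ) -
        ((w ⟨(Pi.single ν (-1 : ZMod L), ν), leader_not_treeEdge ν⟩ * w ⟨(Pi.single μ (-1 : ZMod L), μ), leader_not_treeEdge μ⟩ : SU2) :
          Matrix (Fin 2) (Fin 2) ℂ)) ≤ s)
    (hσ : ∀ μ : Fin 3,
      frobNorm (((g 0 * w ⟨(Pi.single (Equiv.swap (0 : Fin 3) 1 μ) (-1 : ZMod L), Equiv.swap (0 : Fin 3) 1 μ),
          leader_not_treeEdge (Equiv.swap (0 : Fin 3) 1 μ)⟩ : SU2) : Matrix (Fin 2) (Fin 2) ℂ) -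
        ((centreElem (z μ) * w ⟨(Pi.single μ (-1 : ZMod L), μ), leader_not_treeEdge μ⟩ * g 0 : SU2) : Matrix (Fin 2) (Fin 2) ℂ)) ≤ s)
    (hw : ∀ i : OffIdx L, frobNorm ((((if i.1.1 i.1.2 = -1 then w ⟨(Pi.single i.1.2 (-1 : ZMod L), i.1.2), leader_not_treeEdge i.1.2⟩
        else 1)⁻¹ * w i : SU2) : Matrix (Fin 2) (Fin 2) ℂ) - 1) ≤ t₂)
    (hr : ∀ (j : Fin (2 * L - 1)) (e : Edge 3 L), frobNorm ((((glue w e)⁻¹ * r j e : SU2) : Matrix (Fin 2) (Fin 2) ℂ) - 1) ≤ t₂)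
    (hg : ∀ x : Site 3 L, frobNorm ((((centreElem (Bool.xor (z 0 && decide (x 0 ≠ 0)) (Bool.xor (z 1 && decide (x 1 ≠ 0)) (z 2 && decide (x 2 ≠ 0)))) * g 0)⁻¹ *
        g x : SU2) : Matrix (Fin 2) (Fin 2) ℂ) - 1) ≤ t₂) :
    swapRingDeficit L z ((Fin.cons (glue w) r : Fin (2 * L - 1 + 1) → GaugeConfig 3 L SU2), g) ≤ 300 * (L : ℝ) ^ 4 * (t₂ + s) ^ 2 := by
  -- abbreviations
  set σ : Equiv.Perm (Fin 3) := Equiv.swap (0 : Fin 3) 1 with hσdef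
  set C : Fin 3 → SU2 := fun μ => w ⟨(Pi.single μ (-1 : ZMod L), μ), leader_not_treeEdge μ⟩ with hCdef
  set ℓ : Edge 3 L → SU2 := fun e => if e.1 e.2 = -1 then C e.2 else 1 with hℓ
  set ℓ' : Edge 3 L → SU2 := fun e => if e.1 e.2 = -1 then C (σ e.2) else 1 with hℓ'
  -- the parity field, the stripped seam field, the signed letters
  set χ : Site 3 L → SU2 := fun y => centreElem (Bool.xor (z 0 && decide (y 0 ≠ 0)) (Bool.xor (z 1 && decide (y 1 ≠ 0)) (z 2 && decide (y 2 ≠ 0)))) with hχ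
  set gs : Site 3 L → SU2 := fun y => (χ y)⁻¹ * g y with hgs
  set β : Edge 3 L → SU2 := fun e => centreElem (z e.2 && decide (e.1 e.2 = -1)) with hβ
  set ℓs : Edge 3 L → SU2 := fun e => β e * ℓ e with hℓs
  set P : Fin (2 * L - 1 + 1) → GaugeConfig 3 L SU2 := Fin.cons (glue w) r with hP
  have hL1 : (1 : ℝ) ≤ L := by exact_mod_cast NeZero.one_le
  have hL0 : (0 : ℝ) ≤ (L : ℝ) ^ 3 := by positivity
  have hts : 0 ≤ t₂ + s := add_nonneg ht₂ hs
  have hCC' : ∀ μ ν, frobNorm (((C μ * C ν : SU2) : Matrix (Fin 2) (Fin 2) ℂ) - ((C ν * C μ : SU2) : Matrix (Fin 2) (Fin 2) ℂ)) ≤ s := hCC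
  -- the stripped seam field is `t₂`-close to `c = g 0 = gs 0`
  have hχ0 : χ 0 = 1 := by
    simp only [hχ, parity_zero]; simp [centreElem]
  have hgs0 : gs 0 = g 0 := by simp only [hgs, hχ0, inv_one, one_mul]
  have hgs_near : ∀ x, frobNorm ((((gs 0)⁻¹ * gs x : SU2) : Matrix (Fin 2) (Fin 2) ℂ) - 1) ≤ t₂ := by
    intro x
    have h := hg x
    rw [mul_inv_rev, mul_assoc] at h
    rw [hgs0]
    exact h
  -- the seam value `c` intertwines the swapped letters and the SIGNED letters up to `s`
  have hcℓ : ∀ e, frobNorm (((gs 0 * ℓ' e : SU2) : Matrix (Fin 2) (Fin 2) ℂ) - ((ℓs e * gs 0 : SU2) : Matrix (Fin 2) (Fin 2) ℂ)) ≤ s := by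
    intro e
    rw [hgs0]
    simp only [hℓs, hβ, hℓ, hℓ']
    by_cases he : e.1 e.2 = -1
    · rw [if_pos he, if_pos he, decide_eq_true he, Bool.and_true]
      exact hσ e.2
    · rw [if_neg he, if_neg he, decide_eq_false he, Bool.and_false, show centreElem false = (1 : SU2) from rfl, mul_one, one_mul, one_mul,
        sub_self, frobNorm_zero]
      exact hs
  -- slice 0 is `t₂`-close to the letters, linkwise
  have h0ℓ : ∀ e : Edge 3 L, frobNorm (((glue w e : SU2) : Matrix (Fin 2) (Fin 2) ℂ) - (ℓ e : Matrix (Fin 2) (Fin 2) ℂ)) ≤ t₂ := by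
    intro e
    by_cases he : treeEdge e = true
    · have hne := apply_ne_neg_one_of_treeEdge he
      rw [glue_apply_of_tree w he]
      simp only [hℓ, if_neg hne, sub_self, frobNorm_zero]
      exact ht₂
    · rw [glue_apply_of_not_tree w he, ← frobNorm_inv_mul_sub_one]
      exact hw ⟨e, he⟩
  -- the swapped slice 0 is `t₂`-close to the swapped letters
  have h0ℓ' : ∀ e : Edge 3 L, frobNorm (((configPerm σ (glue w) e : SU2) : Matrix (Fin 2) (Fin 2) ℂ) - (ℓ' e : Matrix (Fin 2) (Fin 2) ℂ)) ≤ t₂ := by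
    intro e
    rw [configPerm_apply]
    have key : ℓ (sitePerm σ.symm e.1, σ.symm e.2) = ℓ' e := by
      simp only [hℓ, hℓ', sitePerm_apply, hσdef, Equiv.symm_swap, Equiv.swap_apply_self]
    rw [← key]; exact h0ℓ _
  -- every slice is `t₂`-close to slice 0
  have hP0 : ∀ (i : Fin (2 * L - 1 + 1)) (e : Edge 3 L),
      frobNorm ((P i e : Matrix (Fin 2) (Fin 2) ℂ) - ((glue w e : SU2) : Matrix (Fin 2) (Fin 2) ℂ)) ≤ t₂ := by
    intro i e
    refine Fin.cases ?_ (fun j => ?_) i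
    · simp only [hP, Fin.cons_zero, sub_self, frobNorm_zero]; exact ht₂
    · simp only [hP, Fin.cons_succ]
      rw [← frobNorm_inv_mul_sub_one]; exact hr j e
  -- every slice is in the nearly-commuting box of radii `(s, 2t₂)`
  have hPℓ : ∀ (i : Fin (2 * L - 1 + 1)) (e : Edge 3 L),
      frobNorm ((((ℓ e)⁻¹ * P i e : SU2) : Matrix (Fin 2) (Fin 2) ℂ) - 1) ≤ 2 * t₂ := by
    intro i e
    rw [frobNorm_inv_mul_sub_one]
    exact (frobNorm_sub_le _ _ _).trans (by linarith [hP0 i e, h0ℓ e])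
  have hS : ∀ i : Fin (2 * L - 1 + 1), wilsonAction su2Rep (P i) ≤ 96 * (L : ℝ) ^ 3 * (t₂ + s) ^ 2 := by
    intro i
    have h := wilsonAction_le_of_commBox (P i) C hs hCC' (t₂ := 2 * t₂) (fun e => hPℓ i e)
    have hb : (4 * (2 * t₂) + s) ^ 2 / 2 ≤ 32 * (t₂ + s) ^ 2 := by nlinarith [mul_nonneg ht₂ hs, sq_nonneg s, sq_nonneg t₂]
    nlinarith [hb]
  -- the seam slice: gauge transform, centre twist and axis swap do not change the Wilson action
  have hSg : wilsonAction su2Rep (gaugeTransform g (twist3 z (configPerm σ (P 0)))) ≤ 96 * (L : ℝ) ^ 3 * (t₂ + s) ^ 2 := by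
    rw [wilsonAction_gaugeTransform]
    simp only [twist3]
    rw [wilsonAction_twist_of_mem_center su2Rep 0 (centreElem_mem_center _), wilsonAction_twist_of_mem_center su2Rep 1 (centreElem_mem_center _),
      wilsonAction_twist_of_mem_center su2Rep 2 (centreElem_mem_center _), wilsonAction_configPerm su2Rep continuous_su2Rep]
    exact hS 0
  -- kinetic bonds
  have hkin : ∀ i : Fin (2 * L - 1),
      6 * (L : ℝ) ^ 3 - timeCoupling su2Rep (P i.castSucc) (P i.succ) ≤ 6 * (L : ℝ) ^ 3 * (t₂ + s) ^ 2 := by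
    intro i
    have hd : ∀ e, frobNorm ((P i.castSucc e : Matrix (Fin 2) (Fin 2) ℂ) - (P i.succ e : Matrix (Fin 2) (Fin 2) ℂ)) ≤ 2 * t₂ :=
      fun e => (frobNorm_sub_le _ ((glue w e : SU2) : Matrix (Fin 2) (Fin 2) ℂ) _).trans (by
        rw [frobNorm_sub_comm ((glue w e : SU2) : Matrix (Fin 2) (Fin 2) ℂ)]
        linarith [hP0 i.castSucc e, hP0 i.succ e])
    have h := kinetic_le_of_dist (by positivity) hd
    nlinarith [h, mul_nonneg ht₂ hs, sq_nonneg s]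
  -- the σ-glued TWISTED seam bond
  have hseam : 6 * (L : ℝ) ^ 3 - timeCoupling su2Rep (P (Fin.last (2 * L - 1))) (gaugeTransform g (twist3 z (configPerm σ (P 0)))) ≤
      3 * (L : ℝ) ^ 3 * ((8 * (t₂ + s)) ^ 2 / 2) := by
    have hP00 : P 0 = glue w := by simp only [hP, Fin.cons_zero]
    have hlast : ∀ e, frobNorm ((P (Fin.last (2 * L - 1)) e : Matrix (Fin 2) (Fin 2) ℂ) - (ℓ e : Matrix (Fin 2) (Fin 2) ℂ)) ≤ 2 * t₂ :=
      fun e => (frobNorm_sub_le _ ((glue w e : SU2) : Matrix (Fin 2) (Fin 2) ℂ) _).trans (by linarith [hP0 (Fin.last (2 * L - 1)) e, h0ℓ e])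
    have hσ0 : ∀ e, frobNorm (((configPerm σ (P 0) e : SU2) : Matrix (Fin 2) (Fin 2) ℂ) - (ℓ' e : Matrix (Fin 2) (Fin 2) ℂ)) ≤ 2 * t₂ :=
      fun e => by rw [hP00]; linarith [h0ℓ' e]
    -- the signed last slice `V e = β_e · P_last e` is `2t₂`-close to the signed letters
    have hV : ∀ e, frobNorm ((((β e * P (Fin.last (2 * L - 1)) e : SU2)) : Matrix (Fin 2) (Fin 2) ℂ) - (ℓs e : Matrix (Fin 2) (Fin 2) ℂ)) ≤ 2 * t₂ := by
      intro e
      have h := fd_mul_left (β e) (P (Fin.last (2 * L - 1)) e) (ℓ e)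
      unfold fd at h
      simp only [hℓs]
      rw [h]; exact hlast e
    have hd : ∀ e, frobNorm ((P (Fin.last (2 * L - 1)) e : Matrix (Fin 2) (Fin 2) ℂ) -
        ((gaugeTransform g (twist3 z (configPerm σ (P 0))) e : SU2) : Matrix (Fin 2) (Fin 2) ℂ)) ≤ 8 * (t₂ + s) := by
      intro e
      -- the twisted seam value: `g x · (τ · S e) · g(x')⁻¹ = β_e · (gs x · S e · gs(x')⁻¹)`
      set S : GaugeConfig 3 L SU2 := configPerm σ (P 0) with hSdef
      set τ : SU2 := centreElem (z e.2 && decide (e.1 e.2 = 0)) with hτ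
      have e1 : gaugeTransform g (twist3 z S) e = g e.1 * (τ * S e) * (g (e.1.shift e.2))⁻¹ := by
        rw [show gaugeTransform g (twist3 z S) e = g e.1 * twist3 z S e * (g (e.1.shift e.2))⁻¹ from rfl, twist3_apply, hτ, ite_centreElem]
      have hgx : ∀ y, g y = χ y * gs y := fun y => by simp only [hgs]; rw [mul_inv_cancel_left]
      have hχinv : ∀ y, (χ y)⁻¹ = χ y := fun y => centreElem_inv _
      have hcommχ : ∀ (y : Site 3 L) (X : SU2), χ y * X = X * χ y := fun y X => centreElem_mul_comm _ X
      have hcommτ : ∀ X : SU2, τ * X = X * τ := fun X => centreElem_mul_comm _ X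
      have e2 : g e.1 * (τ * S e) * (g (e.1.shift e.2))⁻¹ = β e * (gs e.1 * S e * (gs (e.1.shift e.2))⁻¹) := by
        have hsign : τ * χ e.1 * χ (e.1.shift e.2) = β e := by
          simp only [hτ, hχ, hβ]; exact linkSign_eq z e.1 e.2
        rw [← hsign, hgx e.1, hgx (e.1.shift e.2)]
        exact seam_conj_factor (hcommχ e.1) (hcommχ (e.1.shift e.2)) hcommτ (hχinv (e.1.shift e.2))
      -- `‖P e − β·G‖ = ‖β·P e − G‖` (`β² = 1`, left invariance)
      have hββ : β e * β e = 1 := centreElem_mul_self _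
      have hflip : frobNorm ((P (Fin.last (2 * L - 1)) e : Matrix (Fin 2) (Fin 2) ℂ) -
          ((β e * (gs e.1 * S e * (gs (e.1.shift e.2))⁻¹) : SU2) : Matrix (Fin 2) (Fin 2) ℂ)) =
          frobNorm ((((gaugeTransform gs S e : SU2)) : Matrix (Fin 2) (Fin 2) ℂ) - ((β e * P (Fin.last (2 * L - 1)) e : SU2) : Matrix (Fin 2) (Fin 2) ℂ)) := by
        have h1 := fd_mul_left (β e) (β e * P (Fin.last (2 * L - 1)) e) (gs e.1 * S e * (gs (e.1.shift e.2))⁻¹)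
        rw [← mul_assoc, hββ, one_mul] at h1
        unfold fd at h1
        rw [h1, frobNorm_sub_comm]
        rfl
      have h2 := frobNorm_gaugeTransform_sub_le_of_twistedSeam (t₂ := 2 * t₂) (g := gs) (U := S) (V := fun e => β e * P (Fin.last (2 * L - 1)) e)
        ℓs ℓ' (fun x => (hgs_near x).trans (by linarith)) hcℓ hσ0 hV e
      rw [e1, e2, hflip]
      linarith [h2]
    exact kinetic_le_of_dist (by positivity) hd
  -- assemble through `swapRingDeficit_eq_sums`
  rw [swapRingDeficit_eq_sums]
  dsimp only
  have hcast : ((2 * L - 1 : ℕ) : ℝ) = 2 * (L : ℝ) - 1 := by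
    have : 1 ≤ L := NeZero.one_le
    rw [Nat.cast_sub (by omega), Nat.cast_mul]; norm_num
  have hA : ∑ i : Fin (2 * L - 1), (6 * (L : ℝ) ^ 3 - timeCoupling su2Rep (P i.castSucc) (P i.succ)) ≤
      (2 * (L : ℝ) - 1) * (6 * (L : ℝ) ^ 3 * (t₂ + s) ^ 2) := by
    calc ∑ i : Fin (2 * L - 1), (6 * (L : ℝ) ^ 3 - timeCoupling su2Rep (P i.castSucc) (P i.succ))
        ≤ ∑ _i : Fin (2 * L - 1), 6 * (L : ℝ) ^ 3 * (t₂ + s) ^ 2 := Finset.sum_le_sum fun i _ => hkin i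
      _ = (2 * (L : ℝ) - 1) * (6 * (L : ℝ) ^ 3 * (t₂ + s) ^ 2) := by
          rw [Finset.sum_const, Finset.card_univ, Fintype.card_fin, nsmul_eq_mul, hcast]
  have hB : ∑ i : Fin (2 * L - 1), (1 / 2 : ℝ) * (wilsonAction su2Rep (P i.castSucc) + wilsonAction su2Rep (P i.succ)) ≤
      (2 * (L : ℝ) - 1) * (96 * (L : ℝ) ^ 3 * (t₂ + s) ^ 2) := by
    calc ∑ i : Fin (2 * L - 1), (1 / 2 : ℝ) * (wilsonAction su2Rep (P i.castSucc) + wilsonAction su2Rep (P i.succ))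
        ≤ ∑ _i : Fin (2 * L - 1), 96 * (L : ℝ) ^ 3 * (t₂ + s) ^ 2 :=
          Finset.sum_le_sum fun i _ => by linarith [hS i.castSucc, hS i.succ]
      _ = (2 * (L : ℝ) - 1) * (96 * (L : ℝ) ^ 3 * (t₂ + s) ^ 2) := by
          rw [Finset.sum_const, Finset.card_univ, Fintype.card_fin, nsmul_eq_mul, hcast]
  have hD : (1 / 2 : ℝ) * (wilsonAction su2Rep (P (Fin.last (2 * L - 1))) + wilsonAction su2Rep (gaugeTransform g (twist3 z (configPerm σ (P 0))))) ≤
      96 * (L : ℝ) ^ 3 * (t₂ + s) ^ 2 := by linarith [hS (Fin.last (2 * L - 1)), hSg]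
  have ht0 : 0 ≤ (t₂ + s) ^ 2 := sq_nonneg _
  have hmono : (L : ℝ) ^ 3 * (t₂ + s) ^ 2 ≤ (L : ℝ) ^ 4 * (t₂ + s) ^ 2 := by
    have h := mul_nonneg (mul_nonneg hL0 (sub_nonneg.2 hL1)) ht0
    nlinarith [h]
  nlinarith [hA, hB, hD, hseam, hmono, mul_nonneg hL0 ht0]

end Summit.QuantumFields.YangMills.Theorems.SwapVirialDeficit.SwapRing

end
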